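import Summits.KontsevichZagierPeriods.KontsevichZagierPeriods.Theorems.RootDecompWalshStrataPiAlgSector
import Literature.NumberTheory.Transcendental.KZDilationMove
import HarnessLib

/-!
# Root decomposition / Walsh strata — the ELLIPSOID orthants `(0,1)⁴ ∩ {Σ aᵢxᵢ² < 1}` descend into `Π^alg`

Generation 12, part 101 of the node `QuadricSignKernel` (route `RootDecompWalshStrata`).

* `of_ellCell_sub_of_ballCell_mem_relations` — the ellipsoid orthant cell `[(0,1)⁴ ∩ {Σ aᵢxᵢ² < 1}, q]`
  (`aᵢ ∈ ℚ`, `aᵢ ≥ 1`) is congruent, by ONE rule-(2) move along the diagonal algebraic dilation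
  `xᵢ ↦ √aᵢ·xᵢ` (a `ℚ`-semialgebraic map — `IsSemialgebraicFunOn.mul_holds` with the algebraic constant
  `√aᵢ` — with constant Jacobian `√(a₀a₁a₂a₃)`; for `aᵢ ≥ 1` the image of the cell is exactly the ball
  orthant cell), to the ball cell with the ALGEBRAIC weight `q/√(a₀a₁a₂a₃)`;
* `of_ballCell_constMul_sub_mem_relations`, `of_ellCell_sub_of_hq2A_mem_relations` — hence (`KZ.scale` of
  the gen-12 ball descent `PiAt.of_ball4_cell_sub_of_hq2Rep_mem_relations`) to the `Π^alg` generator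
  `[(0,1)², (q/(2√(a₀a₁a₂a₃)))/((1+x²)(1+y²))]` — value `qπ²/(32√(a₀a₁a₂a₃))`;
* `algDescentAt_ell` (+ `_rename`, `_rename_reflect`) — the ellipsoid quadric is in the `Π^alg`-class;
* `sum_mem_relations_ellipsoids` — **Conjecture 1 (kernel form) for every family of ellipsoid-orthant
  cells with DIFFERENT rational shape vectors — UNCONDITIONAL** (kernel `PiAlg.algKernel` = Lindemann over `ℚ̄`);
* `sum_mem_relations_genera_and_ellipsoids_of_eulerKZ` (mixed with the orbits of the four genera, given
  `EulerKZ`) and `sum_mem_relations_ball_parab_cone_ellipsoids` (without the split genus, unconditional).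

References: [KontsevichZagier2001] §1.1–1.2 (rule (2); algebraic coefficients); [Lindemann1882];
[BCR1998] Bochnak–Coste–Roy, *Real Algebraic Geometry* §2 (semialgebraic maps).
-/

noncomputable section

open Literature.NumberTheory.Transcendental
open MeasureTheory Set
open MvPolynomial (aeval X C rename bind₁)
open Literature.ModelTheory.ExponentialFields (IsSemialgebraic)
open Summit.KontsevichZagierPeriods.RootDecompWalshStrata.WalshSpanProof (cellRep cellRep_domain
  cellRep_integrand)
open Summit.KontsevichZagierPeriods.RootDecompWalshStrata.QuadricFourRung (totalDegree_ball4Poly_le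
  totalDegree_parab4Poly_le totalDegree_cone4Poly_le totalDegree_split4Poly_le)
open Summit.KontsevichZagierPeriods.RootDecompWalshStrata.Ball4 (ball4Poly aeval_ball4Poly)
open Summit.KontsevichZagierPeriods.RootDecompWalshStrata.Parab4 (parab4Poly)
open Summit.KontsevichZagierPeriods.RootDecompWalshStrata.Cone4 (cone4Poly)
open Summit.KontsevichZagierPeriods.RootDecompWalshStrata.Split4 (split4Poly)
open Summit.KontsevichZagierPeriods.RootDecompWalshStrata.PiSector (hq2Rep hq2Rep_integrand)
open Summit.KontsevichZagierPeriods.RootDecompWalshStrata.PiAt (QuadricDescentAt descentAt_of_cellRep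
  descentAt_rename descentAt_rename_reflect of_ball4_cell_sub_of_hq2Rep_mem_relations EulerKZ
  totalDegree_reflect_le)

namespace Summit.KontsevichZagierPeriods.RootDecompWalshStrata.PiAlg

open Literature.NumberTheory.Transcendental in
open MeasureTheory Set in
open MvPolynomial (aeval X C) in
open Literature.ModelTheory.ExponentialFields (IsSemialgebraic) in
open Summit.KontsevichZagierPeriods.RootDecompWalshStrata.Ball4 (ivSet isSemialgebraic_ivSet ivSet_subset_Icc) in
open Summit.KontsevichZagierPeriods.KontsevichZagierPeriods.Theorems.RootDecompQuadraticDescentLegendre (I1 measurableSet_I1 setIntegral_I1 integrableOn_I1_of integrableOn_Ioo_of_continuous) in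
/-- A rational number is algebraic over `ℚ` (as a real number). [folklore] -/
private theorem isAlgebraic_rat (q : ℚ) : IsAlgebraic ℚ ((q : ℚ) : ℝ) := by
  simpa using isAlgebraic_algebraMap (R := ℚ) (A := ℝ) q

/-! ### The ellipsoid orthants `(0,1)⁴ ∩ {Σ aᵢxᵢ² < 1}` -/

/-- The ellipsoid polynomial `1 − a₀x₀² − a₁x₁² − a₂x₂² − a₃x₃²` (`a ∈ ℚ⁴`). [definition] -/
def ellPoly (a : Fin 4 → ℚ) : MvPolynomial (Fin 4) ℚ :=
  1 - C (a 0) * X 0 ^ 2 - C (a 1) * X 1 ^ 2 - C (a 2) * X 2 ^ 2 - C (a 3) * X 3 ^ 2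

/-- Evaluation of the ellipsoid polynomial. [definition] -/
@[simp] theorem aeval_ellPoly (a : Fin 4 → ℚ) (x : Fin 4 → ℝ) : aeval x (ellPoly a) =
    1 - (a 0 : ℝ) * x 0 ^ 2 - (a 1 : ℝ) * x 1 ^ 2 - (a 2 : ℝ) * x 2 ^ 2 - (a 3 : ℝ) * x 3 ^ 2 := by
  simp [ellPoly]

/-- The ellipsoid polynomial has total degree `≤ 2`. [elementary] -/
theorem totalDegree_ellPoly_le (a : Fin 4 → ℚ) : (ellPoly a).totalDegree ≤ 2 := by
  unfold ellPoly
  have hX : ∀ (i : Fin 4) (b : ℚ), (C b * X i ^ 2 : MvPolynomial (Fin 4) ℚ).totalDegree ≤ 2 := fun i b =>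
    (MvPolynomial.totalDegree_mul _ _).trans (by simp [MvPolynomial.totalDegree_X_pow])
  refine (MvPolynomial.totalDegree_sub _ _).trans (max_le ?_ (hX 3 _))
  refine (MvPolynomial.totalDegree_sub _ _).trans (max_le ?_ (hX 2 _))
  refine (MvPolynomial.totalDegree_sub _ _).trans (max_le ?_ (hX 1 _))
  exact (MvPolynomial.totalDegree_sub _ _).trans (max_le (by simp) (hX 0 _))

/-- The semi-axis scalings `sᵢ = √aᵢ`. [definition] -/
def sax (a : Fin 4 → ℚ) (i : Fin 4) : ℝ := Real.sqrt (a i)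

/-- `√aᵢ > 0` for `aᵢ ≥ 1`. [elementary] -/
theorem sax_pos {a : Fin 4 → ℚ} (ha : ∀ i, 1 ≤ a i) (i : Fin 4) : 0 < sax a i :=
  Real.sqrt_pos.2 (by have := ha i; exact_mod_cast (zero_lt_one.trans_le this))

/-- `√aᵢ ≥ 1` for `aᵢ ≥ 1`. [elementary] -/
theorem one_le_sax {a : Fin 4 → ℚ} (ha : ∀ i, 1 ≤ a i) (i : Fin 4) : 1 ≤ sax a i :=
  (Real.le_sqrt' one_pos).2 (by rw [one_pow]; exact_mod_cast ha i)

/-- `√aᵢ · √aᵢ = aᵢ`. [elementary] -/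
theorem sax_mul_self {a : Fin 4 → ℚ} (ha : ∀ i, 1 ≤ a i) (i : Fin 4) : sax a i * sax a i = a i :=
  Real.mul_self_sqrt (by have := ha i; exact_mod_cast (zero_le_one.trans this))

/-- `√aᵢ` is algebraic (`(√aᵢ)² = aᵢ ∈ ℚ`). [elementary] -/
theorem isAlgebraic_sax {a : Fin 4 → ℚ} (ha : ∀ i, 1 ≤ a i) (i : Fin 4) : IsAlgebraic ℚ (sax a i) :=
  IsAlgebraic.of_pow two_pos (by rw [sq, sax_mul_self ha]; exact isAlgebraic_rat (a i))

/-- The Jacobian `√(a₀a₁a₂a₃) = s₀s₁s₂s₃`. [definition] -/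
def jac (a : Fin 4 → ℚ) : ℝ := sax a 0 * sax a 1 * sax a 2 * sax a 3

/-- The Jacobian is positive. [elementary] -/
theorem jac_pos {a : Fin 4 → ℚ} (ha : ∀ i, 1 ≤ a i) : 0 < jac a :=
  mul_pos (mul_pos (mul_pos (sax_pos ha 0) (sax_pos ha 1)) (sax_pos ha 2)) (sax_pos ha 3)

/-- The Jacobian `√(a₀a₁a₂a₃)` is algebraic. [elementary] -/
theorem isAlgebraic_jac {a : Fin 4 → ℚ} (ha : ∀ i, 1 ≤ a i) : IsAlgebraic ℚ (jac a) :=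
  (((isAlgebraic_sax ha 0).mul (isAlgebraic_sax ha 1)).mul (isAlgebraic_sax ha 2)).mul
    (isAlgebraic_sax ha 3)

/-- `(√(a₀a₁a₂a₃))² = a₀a₁a₂a₃`. [elementary] -/
theorem jac_mul_jac {a : Fin 4 → ℚ} (ha : ∀ i, 1 ≤ a i) :
    jac a * jac a = (a 0 : ℝ) * a 1 * a 2 * a 3 := by
  have e : jac a * jac a = (sax a 0 * sax a 0) * (sax a 1 * sax a 1) * (sax a 2 * sax a 2) *
      (sax a 3 * sax a 3) := by simp only [jac]; ring
  rw [e, sax_mul_self ha, sax_mul_self ha, sax_mul_self ha, sax_mul_self ha]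

/-- The algebraic weight `q/√(a₀a₁a₂a₃)`, written as `(q/(a₀a₁a₂a₃))·√(a₀a₁a₂a₃)`. [definition] -/
def ellWeight (a : Fin 4 → ℚ) (q : ℚ) : ℝ := ((q / (a 0 * a 1 * a 2 * a 3) : ℚ) : ℝ) * jac a

/-- The weight `q/√(a₀a₁a₂a₃)` is algebraic. [elementary] -/
theorem isAlgebraic_ellWeight {a : Fin 4 → ℚ} (ha : ∀ i, 1 ≤ a i) (q : ℚ) :
    IsAlgebraic ℚ (ellWeight a q) :=
  (isAlgebraic_rat _).mul (isAlgebraic_jac ha)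

/-- `(q/√(a₀a₁a₂a₃)) · √(a₀a₁a₂a₃) = q`. [elementary] -/
theorem ellWeight_mul_jac {a : Fin 4 → ℚ} (ha : ∀ i, 1 ≤ a i) (q : ℚ) : ellWeight a q * jac a = q := by
  have hne : ((a 0 : ℝ) * a 1 * a 2 * a 3) ≠ 0 := by
    rw [← jac_mul_jac ha]; exact (mul_pos (jac_pos ha) (jac_pos ha)).ne'
  rw [ellWeight, mul_assoc, jac_mul_jac ha, Rat.cast_div, Rat.cast_mul, Rat.cast_mul, Rat.cast_mul,
    div_mul_cancel₀ _ hne]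

/-- The diagonal dilation `xᵢ ↦ sᵢxᵢ`. [definition] -/
def diag (a : Fin 4 → ℚ) (x : Fin 4 → ℝ) : Fin 4 → ℝ := fun i => sax a i * x i

/-- Its (constant) derivative, the diagonal linear map. [definition] -/
def diagL (a : Fin 4 → ℚ) : (Fin 4 → ℝ) →L[ℝ] (Fin 4 → ℝ) :=
  LinearMap.toContinuousLinearMap (Matrix.toLin' (Matrix.diagonal (sax a)))

/-- The diagonal linear map acts as the diagonal dilation. [elementary] -/
theorem diagL_apply (a : Fin 4 → ℚ) (x : Fin 4 → ℝ) : diagL a x = diag a x := by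
  ext i
  simp [diagL, diag, Matrix.toLin'_apply, Matrix.mulVec_diagonal]

/-- `det diag(√a₀,…,√a₃) = √(a₀a₁a₂a₃)`. [elementary] -/
theorem det_diagL (a : Fin 4 → ℚ) : (diagL a).det = jac a := by
  show LinearMap.det (Matrix.toLin' (Matrix.diagonal (sax a))) = jac a
  rw [LinearMap.det_toLin', Matrix.det_diagonal, Fin.prod_univ_four, jac]

/-- The diagonal dilation is its own derivative. [elementary] -/
theorem hasFDerivAt_diag (a : Fin 4 → ℚ) (x : Fin 4 → ℝ) : HasFDerivAt (diag a) (diagL a) x := by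
  have e : (diagL a : (Fin 4 → ℝ) → (Fin 4 → ℝ)) = diag a := funext (diagL_apply a)
  rw [← e]
  exact (diagL a).hasFDerivAt

/-- The diagonal dilation by the algebraic factors `√aᵢ` is a `ℚ`-semialgebraic map (constant algebraic function × coordinate, `IsSemialgebraicFunOn.mul_holds`). [BCR1998 §2.2] -/
theorem isSemialgebraicMapOn_diag {a : Fin 4 → ℚ} (ha : ∀ i, 1 ≤ a i) {σ : Set (Fin 4 → ℝ)}
    (hσ : IsSemialgebraic ℚ σ) : IsSemialgebraicMapOn ℚ σ (diag a) := by
  refine IsSemialgebraicMapOn.of_forall hσ fun j => ?_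
  have hj : IsSemialgebraicFunOn ℚ σ (fun u : Fin 4 → ℝ => u j) := by
    simpa only [MvPolynomial.aeval_X] using
      isSemialgebraicFunOn_aeval hσ (X j : MvPolynomial (Fin 4) ℚ)
  have h := IsSemialgebraicFunOn.mul_holds
    (isSemialgebraicFunOn_const_of_isAlgebraic hσ (isAlgebraic_sax ha j)) hj
  exact h.congr fun u _ => by simp only [Pi.mul_apply, diag]

/-- The diagonal dilation is injective. [elementary] -/
theorem injOn_diag {a : Fin 4 → ℚ} (ha : ∀ i, 1 ≤ a i) (σ : Set (Fin 4 → ℝ)) : InjOn (diag a) σ := by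
  intro x _ y _ h
  ext i
  have hi := congrFun h i
  simp only [diag] at hi
  exact mul_left_cancel₀ (sax_pos ha i).ne' hi

/-- The ellipsoid orthant cell. [definition] -/
def ellCell (a : Fin 4 → ℚ) : Set (Fin 4 → ℝ) := {x | (∀ j, 0 < x j ∧ x j < 1) ∧ 0 < aeval x (ellPoly a)}

/-- The ball orthant cell. [definition] -/
def ballCell : Set (Fin 4 → ℝ) := {x | (∀ j, 0 < x j ∧ x j < 1) ∧ 0 < aeval x ball4Poly}

/-- `Σ (√aᵢ xᵢ)² = Σ aᵢxᵢ²`. [elementary] -/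
theorem sum_sq_diag (a : Fin 4 → ℚ) (ha : ∀ i, 1 ≤ a i) (x : Fin 4 → ℝ) :
    (diag a x 0) ^ 2 + (diag a x 1) ^ 2 + (diag a x 2) ^ 2 + (diag a x 3) ^ 2 =
      (a 0 : ℝ) * x 0 ^ 2 + (a 1 : ℝ) * x 1 ^ 2 + (a 2 : ℝ) * x 2 ^ 2 + (a 3 : ℝ) * x 3 ^ 2 := by
  simp only [diag]
  rw [mul_pow, mul_pow, mul_pow, mul_pow, sq (sax a 0), sq (sax a 1), sq (sax a 2), sq (sax a 3),
    sax_mul_self ha, sax_mul_self ha, sax_mul_self ha, sax_mul_self ha]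

/-- **The diagonal dilation maps the ellipsoid orthant ONTO the ball orthant** (for `aᵢ ≥ 1`, so that
`yᵢ = √aᵢ xᵢ < 1` is implied by `Σyᵢ² < 1` and the preimage of the unit box stays in the unit box).
[elementary] -/
theorem image_diag_ellCell {a : Fin 4 → ℚ} (ha : ∀ i, 1 ≤ a i) : diag a '' ellCell a = ballCell := by
  ext y
  constructor
  · rintro ⟨x, ⟨hx, hP⟩, rfl⟩
    have hs := sum_sq_diag a ha x
    rw [aeval_ellPoly] at hP
    have hpos : ∀ j, 0 < diag a x j := fun j => mul_pos (sax_pos ha j) (hx j).1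
    have hball : 0 < 1 - diag a x 0 ^ 2 - diag a x 1 ^ 2 - diag a x 2 ^ 2 - diag a x 3 ^ 2 := by
      linarith
    refine ⟨fun j => ⟨hpos j, ?_⟩, by rwa [aeval_ball4Poly]⟩
    have hsq : diag a x j ^ 2 < 1 := by
      have hle : diag a x j ^ 2 ≤ ∑ i, diag a x i ^ 2 :=
        Finset.single_le_sum (f := fun i => diag a x i ^ 2) (fun i _ => sq_nonneg (diag a x i))
          (Finset.mem_univ j)
      rw [Fin.sum_univ_four] at hle
      linarith
    nlinarith [hpos j]
  · rintro ⟨hy, hP⟩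
    rw [aeval_ball4Poly] at hP
    refine ⟨fun i => y i / sax a i, ⟨fun j => ⟨div_pos (hy j).1 (sax_pos ha j), ?_⟩, ?_⟩, ?_⟩
    · rw [div_lt_one (sax_pos ha j)]
      exact (hy j).2.trans_le (one_le_sax ha j)
    · have e : ∀ j, (a j : ℝ) * (y j / sax a j) ^ 2 = y j ^ 2 := fun j => by
        rw [div_pow, sq (sax a j), sax_mul_self ha j, mul_div_cancel₀]
        have := sax_mul_self ha j ▸ (mul_pos (sax_pos ha j) (sax_pos ha j))
        exact this.ne'
      rw [aeval_ellPoly, e, e, e, e]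
      exact hP
    · ext i
      simp only [diag]
      rw [mul_div_cancel₀ _ (sax_pos ha i).ne']

/-- The algebraic weight as an element of `Alg`. [definition] -/
def ellW {a : Fin 4 → ℚ} (ha : ∀ i, 1 ≤ a i) (q : ℚ) : Alg :=
  ⟨ellWeight a q, mem_Alg_iff.2 (isAlgebraic_ellWeight ha q)⟩

/-- The coercion of `ellW`. [definition] -/
@[simp] theorem coe_ellW {a : Fin 4 → ℚ} (ha : ∀ i, 1 ≤ a i) (q : ℚ) : (ellW ha q : ℝ) = ellWeight a q := rfl

/-- **ONE rule-(2) move: the ellipsoid orthant cell `[(0,1)⁴ ∩ {Σaᵢxᵢ² < 1}, q]` is congruent to the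
ball orthant cell with the ALGEBRAIC weight `q/√(a₀a₁a₂a₃)`** (change of variables `yᵢ = √aᵢ·xᵢ`, a
`ℚ`-semialgebraic map with constant Jacobian `√(a₀a₁a₂a₃)`). [KontsevichZagier2001 §1.2 rule (2); this node] -/
theorem of_ellCell_sub_of_ballCell_mem_relations {a : Fin 4 → ℚ} (ha : ∀ i, 1 ≤ a i) (q : ℚ) :
    KZ.of (cellRep (ellPoly a) q) -
      KZ.of ((cellRep ball4Poly 1).constMul (ellW ha q : ℝ) (isAlgebraic_coe _)) ∈ KZ.relations := by
  refine KZ.changeOfVariablesRel_subset_relations ⟨4, cellRep (ellPoly a) q,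
    (cellRep ball4Poly 1).constMul (ellW ha q : ℝ) (isAlgebraic_coe _), diag a,
    fun _ => diagL a, isSemialgebraicMapOn_diag ha (cellRep (ellPoly a) q).isSemialgebraic_domain,
    fun x _ => (hasFDerivAt_diag a x).hasFDerivWithinAt, injOn_diag ha _, ?_, fun x _ => ?_, rfl⟩
  · show ballCell = diag a '' ellCell a
    rw [image_diag_ellCell ha]
  · rw [det_diagL, abs_of_pos (jac_pos ha)]
    simp only [KZ.IntegralRep.integrand_constMul, cellRep_integrand, Rat.cast_one, mul_one, coe_ellW]
    exact (ellWeight_mul_jac ha q).symm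

/-- **The ball cell with an algebraic weight `w` descends to the `Π^alg` generator
`[(0,1)², (w/2)/((1+x²)(1+y²))]`** (`KZ.scale` of the gen-12 ball descent
`PiAt.of_ball4_cell_sub_of_hq2Rep_mem_relations`, then an integrand identity). [this node] -/
theorem of_ballCell_constMul_sub_mem_relations (w : Alg) :
    KZ.of ((cellRep ball4Poly 1).constMul (w : ℝ) (isAlgebraic_coe w)) -
      KZ.of (hq2A (w * ratA (1 / 2))) ∈ KZ.relations := by
  have h1 : KZ.of ((cellRep ball4Poly 1).constMul (w : ℝ) (isAlgebraic_coe w)) -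
      KZ.of ((hq2Rep (1 / 2)).constMul (w : ℝ) (isAlgebraic_coe w)) ∈ KZ.relations := by
    have h := KZ.scale_mem_relations (w : ℝ) (isAlgebraic_coe w)
      (of_ball4_cell_sub_of_hq2Rep_mem_relations 1)
    rwa [map_sub, KZ.scale_of, KZ.scale_of] at h
  have h2 : KZ.of ((hq2Rep (1 / 2)).constMul (w : ℝ) (isAlgebraic_coe w)) -
      KZ.of (hq2A (w * ratA (1 / 2))) ∈ KZ.relations := by
    refine KZ.of_sub_of_mem_relations_of_eqOn rfl fun z _ => ?_
    simp only [KZ.IntegralRep.integrand_constMul, hq2Rep_integrand, hq2A_integrand, Subalgebra.coe_mul,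
      coe_ratA]
    push_cast
    ring
  have e : KZ.of ((cellRep ball4Poly 1).constMul (w : ℝ) (isAlgebraic_coe w)) -
      KZ.of (hq2A (w * ratA (1 / 2))) =
      (KZ.of ((cellRep ball4Poly 1).constMul (w : ℝ) (isAlgebraic_coe w)) -
        KZ.of ((hq2Rep (1 / 2)).constMul (w : ℝ) (isAlgebraic_coe w))) +
      (KZ.of ((hq2Rep (1 / 2)).constMul (w : ℝ) (isAlgebraic_coe w)) -
        KZ.of (hq2A (w * ratA (1 / 2)))) := by abel
  rw [e]
  exact add_mem h1 h2

/-- **The ellipsoid orthant cell descends into `Π^alg`:**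
`[(0,1)⁴ ∩ {Σaᵢxᵢ² < 1}, q] ≡ [(0,1)², (q/(2√(a₀a₁a₂a₃)))/((1+x²)(1+y²))]` (two moves + bookkeeping).
[KontsevichZagier2001 §1.2; this node] -/
theorem of_ellCell_sub_of_hq2A_mem_relations {a : Fin 4 → ℚ} (ha : ∀ i, 1 ≤ a i) (q : ℚ) :
    KZ.of (cellRep (ellPoly a) q) - KZ.of (hq2A (ellW ha q * ratA (1 / 2))) ∈ KZ.relations := by
  have e : KZ.of (cellRep (ellPoly a) q) - KZ.of (hq2A (ellW ha q * ratA (1 / 2))) =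
      (KZ.of (cellRep (ellPoly a) q) -
        KZ.of ((cellRep ball4Poly 1).constMul (ellW ha q : ℝ) (isAlgebraic_coe _))) +
      (KZ.of ((cellRep ball4Poly 1).constMul (ellW ha q : ℝ) (isAlgebraic_coe _)) -
        KZ.of (hq2A (ellW ha q * ratA (1 / 2)))) := by abel
  rw [e]
  exact add_mem (of_ellCell_sub_of_ballCell_mem_relations ha q) (of_ballCell_constMul_sub_mem_relations _)

/-- **The ellipsoid orthant quadric `1 − Σaᵢxᵢ²` (`aᵢ ∈ ℚ`, `aᵢ ≥ 1`) is in the `Π^alg`-class.** [this node] -/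
theorem algDescentAt_ell {a : Fin 4 → ℚ} (ha : ∀ i, 1 ≤ a i) : QuadricDescentAt algGens (ellPoly a) :=
  descentAt_of_cellRep fun _ q => ⟨KZ.of (hq2A (ellW ha q * ratA (1 / 2))),
    AddSubgroup.subset_closure (of_hq2A_mem_algGens _), of_ellCell_sub_of_hq2A_mem_relations ha q⟩

/-- Orbit forms: coordinate permutations and box reflections of ellipsoid orthants. [this node] -/
theorem algDescentAt_ell_rename {a : Fin 4 → ℚ} (ha : ∀ i, 1 ≤ a i) (σ : Equiv.Perm (Fin 4)) :
    QuadricDescentAt algGens (rename σ (ellPoly a)) :=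
  descentAt_rename σ (algDescentAt_ell ha)

/-- Box reflections of coordinate-permuted ellipsoid orthants are in the `Π^alg`-class. [this node] -/
theorem algDescentAt_ell_rename_reflect {a : Fin 4 → ℚ} (ha : ∀ i, 1 ≤ a i) (σ : Equiv.Perm (Fin 4))
    (j : Fin 4) : QuadricDescentAt algGens (rename σ (bind₁ (KZ.reflectSubst j) (ellPoly a))) :=
  descentAt_rename_reflect σ j (totalDegree_ellPoly_le a) (algDescentAt_ell ha)

/-! ### Conjecture 1 (kernel form) for ellipsoid families — UNCONDITIONAL -/

/-- **Conjecture 1 (kernel form) HOLDS for every family of ellipsoid-orthant cells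
`[(0,1)⁴ ∩ {Σⱼ aᵢⱼxⱼ² < 1}, qᵢ]` with arbitrary (different) rational shape vectors `aᵢ ≥ 1` — NO ORACLE.**
The values `qᵢπ²/(32√(aᵢ₀aᵢ₁aᵢ₂aᵢ₃))` range over infinitely many `ℚ`-lines; the kernel is decided by
Lindemann over `ℚ̄`. [Lindemann1882; KontsevichZagier2001 §1.2; this node] -/
theorem sum_mem_relations_ellipsoids (k : ℕ) (a : Fin k → Fin 4 → ℚ) (ha : ∀ i j, 1 ≤ a i j)
    (q : Fin k → ℚ) (ρ : Fin k → KZ.IntegralRep 4) (c : Fin k → ℤ)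
    (hρ : ∀ i, (ρ i).domain = {x | (∀ j, 0 < x j ∧ x j < 1) ∧ 0 < MvPolynomial.aeval x (ellPoly (a i))} ∧
      ∀ x ∈ (ρ i).domain, (ρ i).integrand x = (q i : ℝ))
    (hv : KZ.eval (∑ i, c i • KZ.of (ρ i)) = 0) : (∑ i, c i • KZ.of (ρ i)) ∈ KZ.relations :=
  sum_mem_relations_alg k (fun _ => 4) (fun i => ellPoly (a i)) q ρ c (fun i => algDescentAt_ell (ha i)) hρ
    (fun i => totalDegree_ellPoly_le (a i)) hv

/-- **Conjecture 1 (kernel form) for every MIXED family drawn from the orbits of the FOUR GENERA (ball,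
split quadric, paraboloid, cone) AND of the ELLIPSOID ORTHANTS `Σaⱼxⱼ² < 1` (`a ≥ 1` rational, any
shapes), given only Euler's `6ζ(2) = π²` as a KZ-relation (`EulerKZ`, a tree theorem by name; needed for
the split genus alone).** [Lindemann1882; Euler1735; KontsevichZagier2001 §1.2, §4.1; this node] -/
theorem sum_mem_relations_genera_and_ellipsoids_of_eulerKZ (hE : EulerKZ) (k : ℕ)
    (P : Fin k → MvPolynomial (Fin 4) ℚ) (q : Fin k → ℚ) (ρ : Fin k → KZ.IntegralRep 4) (c : Fin k → ℤ)
    (hP : ∀ i, ∃ (σ : Equiv.Perm (Fin 4)) (j : Fin 4) (Q : MvPolynomial (Fin 4) ℚ),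
      (Q = ball4Poly ∨ Q = split4Poly ∨ Q = parab4Poly ∨ Q = cone4Poly ∨
        ∃ a : Fin 4 → ℚ, (∀ i, 1 ≤ a i) ∧ Q = ellPoly a) ∧
      (P i = rename σ Q ∨ P i = rename σ (bind₁ (KZ.reflectSubst j) Q)))
    (hρ : ∀ i, (ρ i).domain = {x | (∀ j, 0 < x j ∧ x j < 1) ∧ 0 < MvPolynomial.aeval x (P i)} ∧
      ∀ x ∈ (ρ i).domain, (ρ i).integrand x = (q i : ℝ))
    (hv : KZ.eval (∑ i, c i • KZ.of (ρ i)) = 0) : (∑ i, c i • KZ.of (ρ i)) ∈ KZ.relations := by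
  have hQ : ∀ Q : MvPolynomial (Fin 4) ℚ,
      (Q = ball4Poly ∨ Q = split4Poly ∨ Q = parab4Poly ∨ Q = cone4Poly ∨
        ∃ a : Fin 4 → ℚ, (∀ i, 1 ≤ a i) ∧ Q = ellPoly a) →
      Q.totalDegree ≤ 2 ∧ QuadricDescentAt algGens Q := by
    rintro Q (rfl | rfl | rfl | rfl | ⟨a, ha, rfl⟩)
    · exact ⟨totalDegree_ball4Poly_le, algDescentAt_ball4⟩
    · exact ⟨totalDegree_split4Poly_le, algDescentAt_split4_of_eulerKZ hE⟩
    · exact ⟨totalDegree_parab4Poly_le, algDescentAt_parab4⟩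
    · exact ⟨totalDegree_cone4Poly_le, algDescentAt_cone4⟩
    · exact ⟨totalDegree_ellPoly_le a, algDescentAt_ell ha⟩
  refine sum_mem_relations_alg k (fun _ => 4) P q ρ c (fun i => ?_) hρ (fun i => ?_) hv
  · obtain ⟨σ, j, Q, hQ4, h | h⟩ := hP i <;> rw [h]
    · exact descentAt_rename σ (hQ Q hQ4).2
    · exact descentAt_rename_reflect σ j (hQ Q hQ4).1 (hQ Q hQ4).2
  · obtain ⟨σ, j, Q, hQ4, h | h⟩ := hP i <;> rw [h] <;>
      refine (MvPolynomial.totalDegree_rename_le _ _).trans ?_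
    · exact (hQ Q hQ4).1
    · exact (totalDegree_reflect_le j Q).trans (hQ Q hQ4).1

/-- **Unconditional corollary without the split genus:** mixed families from the orbits of the ball,
the paraboloid, the cone and all ellipsoid orthants. [Lindemann1882; KontsevichZagier2001 §1.2; this node] -/
theorem sum_mem_relations_ball_parab_cone_ellipsoids (k : ℕ)
    (P : Fin k → MvPolynomial (Fin 4) ℚ) (q : Fin k → ℚ) (ρ : Fin k → KZ.IntegralRep 4) (c : Fin k → ℤ)
    (hP : ∀ i, ∃ (σ : Equiv.Perm (Fin 4)) (j : Fin 4) (Q : MvPolynomial (Fin 4) ℚ),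
      (Q = ball4Poly ∨ Q = parab4Poly ∨ Q = cone4Poly ∨
        ∃ a : Fin 4 → ℚ, (∀ i, 1 ≤ a i) ∧ Q = ellPoly a) ∧
      (P i = rename σ Q ∨ P i = rename σ (bind₁ (KZ.reflectSubst j) Q)))
    (hρ : ∀ i, (ρ i).domain = {x | (∀ j, 0 < x j ∧ x j < 1) ∧ 0 < MvPolynomial.aeval x (P i)} ∧
      ∀ x ∈ (ρ i).domain, (ρ i).integrand x = (q i : ℝ))
    (hv : KZ.eval (∑ i, c i • KZ.of (ρ i)) = 0) : (∑ i, c i • KZ.of (ρ i)) ∈ KZ.relations := by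
  have hQ : ∀ Q : MvPolynomial (Fin 4) ℚ,
      (Q = ball4Poly ∨ Q = parab4Poly ∨ Q = cone4Poly ∨
        ∃ a : Fin 4 → ℚ, (∀ i, 1 ≤ a i) ∧ Q = ellPoly a) →
      Q.totalDegree ≤ 2 ∧ QuadricDescentAt algGens Q := by
    rintro Q (rfl | rfl | rfl | ⟨a, ha, rfl⟩)
    · exact ⟨totalDegree_ball4Poly_le, algDescentAt_ball4⟩
    · exact ⟨totalDegree_parab4Poly_le, algDescentAt_parab4⟩
    · exact ⟨totalDegree_cone4Poly_le, algDescentAt_cone4⟩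
    · exact ⟨totalDegree_ellPoly_le a, algDescentAt_ell ha⟩
  refine sum_mem_relations_alg k (fun _ => 4) P q ρ c (fun i => ?_) hρ (fun i => ?_) hv
  · obtain ⟨σ, j, Q, hQ4, h | h⟩ := hP i <;> rw [h]
    · exact descentAt_rename σ (hQ Q hQ4).2
    · exact descentAt_rename_reflect σ j (hQ Q hQ4).1 (hQ Q hQ4).2
  · obtain ⟨σ, j, Q, hQ4, h | h⟩ := hP i <;> rw [h] <;>
      refine (MvPolynomial.totalDegree_rename_le _ _).trans ?_
    · exact (hQ Q hQ4).1
    · exact (totalDegree_reflect_le j Q).trans (hQ Q hQ4).1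

end Summit.KontsevichZagierPeriods.RootDecompWalshStrata.PiAlg

end
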